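import Summits.ABC.ABC.Theses.OmegaSplitFewPrime
import Summits.ABC.ABC.Theorems.RibetTakahashiSplitOmegaLiftAssemblyLift
import Literature.NumberTheory.DiophantineGeometry.AbcImpliesHall

/-!
# `FewPrimeUniformABC` (stmt-ABC-19049): its natural strengthenings are summit-equivalent, and
coprimality is load-bearing

Negative-side support lemmas for the crux
`Summit.ABC.ABC.Theses.OmegaSplitFewPrime.FewPrimeUniformABC` (abc with a constant `C(W, ε)` on
the cells `4 ≤ ω(abc) ≤ W`, route OmegaSplitFewPrime), from the refuter's birth attack (2026-08-17):

* `fewPrimeUniformABC_dropUpper_iff_abc` — dropping the upper cut `ω(abc) ≤ W` (i.e. abc on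
  `{ω(abc) ≥ 4}` with one constant `C(ε)`) is EQUIVALENT to `ABC`, by the landed ω-lift
  `OmegaLift.abc_of_manyPrimes` (cubing identities breed primes into any triple at bounded
  exponent cost). So the cut `ω ≤ W` is exactly what keeps the crux below the summit.
* `fewPrimeUniformABC_uniformW_iff_abc` — asking for the constant to be uniform in `W`
  (quantifier swap `∀ ε ∃ C ∀ W`) is likewise EQUIVALENT to `ABC`: the order `∀ W ∃ C(W, ε)` is
  load-bearing, not cosmetic.
* `fewPrimeUniformABC_false_without_coprime` — with `Nat.Coprime a b` dropped (positivity and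
  `a + b = c` kept) the cell statement is FALSE already at `W = 4`, `ε = 1`: the triples
  `(d, d, 2d)`, `d = 210^m`, have `ω(d·d·2d) = 4`, `rad ≤ 210` and `c = 2·210^m` unbounded.

None of these touches the crux itself (which is implied by `ABC`: a cell of the summit); they
record which mutations of the statement leave the intended regime.
-/

-- `Summit.<Summit>.<Problem>` is the mandated summit-side namespace (CONVENTIONS §2); for the
-- single-conjunct summit `ABC` the two coincide, so the duplicate `ABC.ABC` is deliberate.
set_option linter.dupNamespace false

namespace Summit.ABC.ABC.Theorems.FewPrimeUniformABC.Negative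

open Literature.NumberTheory.DiophantineGeometry UniqueFactorizationMonoid

/-- **Dropping the upper cut gives the summit.** abc with one constant `C(ε)` on `{ω(abc) ≥ 4}`
is equivalent to `ABC` (`←`: restrict; `→`: `OmegaLift.abc_of_manyPrimes 4`). [folklore] -/
theorem fewPrimeUniformABC_dropUpper_iff_abc :
    (∀ ε : ℝ, 0 < ε → ∃ C : ℝ, 0 < C ∧ ∀ a b c : ℕ, IsABCTriple a b c →
      4 ≤ (a * b * c).primeFactors.card → (c : ℝ) < C * ((rad a b c : ℕ) : ℝ) ^ (1 + ε)) ↔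
    _root_.ABC := by
  constructor
  · intro h
    exact OmegaLift.abc_of_manyPrimes 4 fun ε hε => by
      obtain ⟨C, -, h'⟩ := h ε hε
      exact ⟨C, h'⟩
  · intro h ε hε
    obtain ⟨C, hC, h'⟩ := (ABC_iff.mp h) ε hε
    exact ⟨C, hC, fun a b c habc _ => h' a b c habc⟩

/-- **A constant uniform in `W` gives the summit.** The cell statement of `FewPrimeUniformABC` with
the quantifiers swapped to `∀ ε ∃ C ∀ W` is equivalent to `ABC`. [folklore] -/
theorem fewPrimeUniformABC_uniformW_iff_abc :
    (∀ ε : ℝ, 0 < ε → ∃ C : ℝ, 0 < C ∧ ∀ W : ℕ, ∀ a b c : ℕ, IsABCTriple a b c →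
      4 ≤ (a * b * c).primeFactors.card → (a * b * c).primeFactors.card ≤ W →
      (c : ℝ) < C * ((rad a b c : ℕ) : ℝ) ^ (1 + ε)) ↔
    _root_.ABC := by
  rw [← fewPrimeUniformABC_dropUpper_iff_abc]
  constructor
  · intro h ε hε
    obtain ⟨C, hC, h'⟩ := h ε hε
    exact ⟨C, hC, fun a b c habc h4 => h' _ a b c habc h4 le_rfl⟩
  · intro h ε hε
    obtain ⟨C, hC, h'⟩ := h ε hε
    exact ⟨C, hC, fun W a b c habc h4 _ => h' a b c habc h4⟩

/-- The prime factors of `210 = 2·3·5·7`. [folklore] -/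
theorem primeFactors_two_hundred_ten : (210 : ℕ).primeFactors = {2, 3, 5, 7} := by
  rw [show (210 : ℕ) = 2 * 3 * 5 * 7 by norm_num, Nat.primeFactors_mul (by norm_num) (by norm_num),
    Nat.primeFactors_mul (by norm_num) (by norm_num), Nat.primeFactors_mul (by norm_num) (by norm_num),
    Nat.Prime.primeFactors Nat.prime_two, Nat.Prime.primeFactors Nat.prime_three,
    Nat.Prime.primeFactors (by norm_num : Nat.Prime 5),
    Nat.Prime.primeFactors (by norm_num : Nat.Prime 7)]
  decide

/-- **Coprimality is load-bearing on the cell `ω = 4`.** The cell statement of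
`FewPrimeUniformABC` with `Nat.Coprime a b` dropped from `IsABCTriple` fails at `W = 4`, `ε = 1`:
`(d, d, 2d)` with `d = 210^(t+3)`, `t = ⌈C⌉₊`, has `ω = 4`, `rad ≤ 210` and
`C · rad² ≤ C · 210² ≤ 210^t · 2 · 210³ = c`. [folklore] -/
theorem fewPrimeUniformABC_false_without_coprime :
    ¬ ∀ W : ℕ, ∀ ε : ℝ, 0 < ε → ∃ C : ℝ, 0 < C ∧ ∀ a b c : ℕ, 0 < a → 0 < b → a + b = c →
        4 ≤ (a * b * c).primeFactors.card → (a * b * c).primeFactors.card ≤ W →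
        (c : ℝ) < C * ((rad a b c : ℕ) : ℝ) ^ (1 + ε) := by
  intro h
  obtain ⟨C, hC, hWC⟩ := h 4 1 one_pos
  set t : ℕ := ⌈C⌉₊ with ht
  set d : ℕ := 210 ^ (t + 3) with hd
  have hdpos : 0 < d := by positivity
  have hprod : d * d * (2 * d) = 2 * 210 ^ (3 * (t + 3)) := by rw [hd]; ring
  have hcard : (d * d * (2 * d)).primeFactors.card = 4 := by
    rw [hprod, Nat.primeFactors_mul (by norm_num) (by positivity), Nat.primeFactors_pow _ (by omega),
      primeFactors_two_hundred_ten, Nat.Prime.primeFactors Nat.prime_two]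
    decide
  have hlt := hWC d d (2 * d) hdpos hdpos (two_mul d).symm hcard.ge hcard.le
  -- rad(d·d·2d) ≤ 210, since d·d·2d = 2·210^(3(t+3)) ∣ 210^(3(t+3)+1)
  have hrad : rad d d (2 * d) ≤ 210 := by
    rw [rad_def]
    refine radical_le_of_dvd_pow (n := 3 * (t + 3) + 1) (by norm_num) ?_
    calc d * d * (2 * d) = 210 ^ (3 * (t + 3)) * 2 := by rw [hd]; ring
      _ ∣ 210 ^ (3 * (t + 3)) * 210 := mul_dvd_mul_left _ (by norm_num)
      _ = 210 ^ (3 * (t + 3) + 1) := (pow_succ _ _).symm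
  -- sizes in ℝ
  have hradR : ((rad d d (2 * d) : ℕ) : ℝ) ≤ 210 := by exact_mod_cast hrad
  have htC : C ≤ t := Nat.le_ceil C
  have htpow : (t : ℝ) ≤ (210 : ℝ) ^ t := by
    exact_mod_cast (Nat.lt_pow_self (by norm_num : 1 < 210)).le
  have hcR : ((2 * d : ℕ) : ℝ) = 2 * 210 ^ 3 * (210 : ℝ) ^ t := by
    rw [hd]; push_cast; ring
  have key : C * ((rad d d (2 * d) : ℕ) : ℝ) ^ ((1 : ℝ) + 1) ≤ ((2 * d : ℕ) : ℝ) := by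
    rw [show ((1 : ℝ) + 1) = 2 by norm_num, Real.rpow_two, hcR]
    calc C * ((rad d d (2 * d) : ℕ) : ℝ) ^ 2 ≤ C * 210 ^ 2 := by gcongr
      _ ≤ (t : ℝ) * 210 ^ 2 := by gcongr
      _ ≤ (t : ℝ) * (2 * 210 ^ 3) := by gcongr; norm_num
      _ ≤ (210 : ℝ) ^ t * (2 * 210 ^ 3) := by gcongr
      _ = 2 * 210 ^ 3 * (210 : ℝ) ^ t := by ring
  exact absurd hlt (not_lt.mpr key)

end Summit.ABC.ABC.Theorems.FewPrimeUniformABC.Negative
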